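import Literature.MathematicalPhysics.QuantumFieldTheory.Balaban1983to89.B5Hk163Strip
import Literature.MathematicalPhysics.QuantumFieldTheory.Balaban1983to89.B4StripSums

/-!
# `Balaban1983to89.B5Hk163Alias` — the `n`-UNIFORM ALIAS SUM and the ALIAS RE-INDEXING COVARIANCE of the continued (1.63) multiplier of `H_k` on the zero-free strip (cell node X10, successor of `B5Hk163Strip`)

T. Bałaban, *Propagators and renormalization transformations for lattice gauge theories. I*, Commun. Math.
Phys. **95**, 17–40 (1984) [`Balaban1984PropagatorsI`, cell paper B5], (1.63) p. 28 [PDF 12] and the two sentences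
following it, p. 28 bottom – p. 29 top [PDF 12–13] (renders `1984-cmp95-propagators-rt-I-p012-x2.png`,
`…-p013-x2.png`, read as images by this unit), verbatim: «This expression is well defined and bounded for all values
of `l` and `p′`, including `p′ = 0` where it is defined as a limit for `p′ → 0`.  Another important property is that
the sum over `l` of the absolute value of this expression multiplied by `|∂_ν(p′+l)||p′+l|^α` is bounded by a constant
dependent on `d` only. This implies bounds on `(1/|x′−x|^α)|∂_ν(H_kB)_μ(x′) − ∂_ν(H_kB)_μ(x)|` (see the proof of
Lemma 2.4 in [2].)»  ([2] = `Balaban1983RegularityDecay`, cell paper B4.)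

CITATION HEADER (lean-in-tree rule).  This module is a SUPPLEMENT, not a quotation: it proves, for the regrouped
zero-free normal form `h163 μ λ l (p′)` of the coefficient of `B̃_λ(p′)` in `(H_kB)~_μ(p′+l)` (module `B5Hk163Strip`,
whose §6 bounds every alias term separately), the UNWEIGHTED alias-sum bound `Σ_l ‖h_{l;μλ}(p′)‖ ≤ S₁₆₃(d)` for COMPLEX
`p′` in the zero-free strip, uniformly in `n = L^k`, and the re-indexing law `h_l(p′ + 2πe_ν) = h_{σ_ν l}(p′)` across
the strip sides.  B5 prints neither a complex continuation nor this unweighted sum; the printed (stronger, weighted,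
real-`p′`) sentence quoted above is NOT reproduced (HONEST SCOPE (i)).
Everything below is `[folklore]` audit mathematics; `[cite: …]` tags mark the location of printed TEXT only.
ABSOLUTE RULE honoured: no statement of the papers is used as a hypothesis; the imports are kernel-proved tree
modules only (`B5Hk163Strip` = the regrouped symbol and its zero-free strip; `B4StripSums` = the `n`-uniform
residue-sum engine `ω_n(j) = min(j+1, n−j)`, `W_n(l) = Σ_{l_ν≠0} ω_n(l_ν)²`, `ζ_d`, built by cell lineage adv4 for the
(2.46) multiplier of [2]).  No constant below (`cTa163`, `cA163`, `cTail163`, `Msum163`, …) is attributed to print.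

THE MECHANISM (the audit's; Bałaban gives no proof here).  On the fat region `|Re p′_ν| ≤ π + r`, `|Im p′_ν| ≤ 2r`
(`r ≤ 1/4`, `d r² ≤ 1/16`) the continued leaves DECAY in the alias index: `‖v̄C_ν(p′+l)‖ ≤ 12/ω_n(l_ν)`
(`B4StripSums.norm_v_le`; first power, NOT summable alone: `Σ_j ω_n(j)⁻¹ ∼ log n`), `‖|v_μ|²(p′+l)‖ ≤ 64/ω_n(l_μ)²`,
while the shifted denominators GROW: `Re Δ(p′+l) ≥ (7/64)·W_n(l)` (`B4StripSums.re_DeltaXi_shift_ge_W`), whence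
`‖ρ_l‖ ≲ d/W_n(l)`, `‖T(l,l′)‖ ≲ d²/W_n(l)²`, `‖T(l′,l)‖ ≲ d²/W_n(l)`.  The head term `ū v̄_μ ρ_l/Y_μ` is then
`≲ Π_ν ω_n(l_ν)^{−1}·W_n(l)^{−1} ≤ Π_ν ω_n(l_ν)^{−(1+2/d)}` (even split `B4StripSums.inv_W_le_prod_rpow`), summable
uniformly in `n` (`Σ_{j<n} ω_n(j)^{−(1+2/d)} ≤ 2ζ_d`).  The tail term `∂_μ(p′+l)ū(p′+l)·Σ_{l′≠l}A_{l,l′}/𝒩·…` has NO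
decay in `l_μ` from its prefix (`‖∂_μ(p′+l)v̄C_μ(p′+l)‖ ≤ 4` only, the price of `|∂_μ(p′+l)| ∼ n`), so the quadratic
gains are split UNEVENLY (§2): `W_n(l)^{−1} ≤ Π_{ν≠μ} ω_n(l_ν)^{−2/d}` and `W_n(l)^{−2} ≤ ω_n(l_μ)^{−2}Π_{ν≠μ}ω_n(l_ν)^{−2/d}`,
the missing `ω_n(l_μ)^{−2}` of the second piece of `A_{l,l′}` coming from `|v_μ(p′+l)|²`; the tail is
`≲ ω_n(l_μ)^{−2}·Π_{ν≠μ} ω_n(l_ν)^{−(1+2/d)}`, summed coordinatewise to `2ζ_2·(24ζ_d)^{d−1}`.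

CONTENT.
* §1 dictionary to `B4StripSums`: `vCbar = v`, `rho = R(·, m² = 0)`; the decaying leaf bounds `norm_vCbar_le_omega`,
  `norm_uCbar_le_prod`, `norm_dC_mul_uCbar_le_prod`, `norm_uFactor_le_omega`, `norm_rho_le_W`, `inv_norm_DeltaXi_shift_le`;
* §2 the uneven splits `inv_W_le_prod_erase`, `inv_W_sq_le` and the coordinate sums `sum_decay_le`, `sum_inv_sq_le`;
* §3 decaying bounds: `norm_Tfac_le_W_sq`, `norm_Tfac_le_W`, `norm_sum_Afac_le_decay`, `norm_headC_le_decay`,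
  `norm_tailC_le_decay` (on `Strip d κ`, `0 ≤ κ ≤ kappa163 d`, all `n ≥ 1`);
* §4 **the alias sums**: `sum_norm_headC_le` (`≤ Shead163 d`), `sum_norm_tailC_le` (`≤ Stail163 d`) and the main
  theorem `sum_norm_h163_le`: `Σ_{l ∈ 2π{0,…,n−1}^d} ‖h163 μ λ l (p′)‖ ≤ Msum163 d` for `p′ ∈ Strip d κ`,
  `0 ≤ κ ≤ kappa163 d`, every `n ≥ 1`, `μ`, `λ` (explicit crude `d`-only constant);
* §5 **the alias re-indexing covariance** `h163_tr`: for `p′ ∈ Strip d κ` with `Re p′_ν = −π` (so that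
  `p′ + 2πe_ν` is the opposite side point), `h163 μ λ l (p′ + 2πe_ν) = h163 μ λ (σ_ν l) p′`,
  `σ_ν = B5Strip145Analytic.sigma` (`l ↦ l + 2πe_ν mod 2πn`); proved from the generic formulas `rho_eq_div`,
  `Tfac_eq_div` (valid once `Δ(p′) ≠ 0`, which `B5Symbol166Strip.edge_conditions` supplies at side points together
  with `Δ(p′ + 2πe_ν) ≠ 0`), the leaf laws `vCbar_tr`, `uCbar_tr`, `dC_tr`, `expFacNeg_tr`, and the quasi-periodicity
  of the regrouped denominators (`Yc_tr_mul`, `prodYc_tr_mul`, `F66_tr_mul`, `Ncal_tr` of the b05 lineage): `headC`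
  is covariant by itself (`headC_tr`), `tailC` and `gdir_λ` only jointly (`tailC_mul_gdir_tr`); and
  `sum_norm_h163_sigma` (the permuted alias sum is the alias sum).

HONEST SCOPE.  (i) The printed property is the WEIGHTED real-momentum sum `Σ_l |h_l(p′)|·|∂_ν(p′+l)||p′+l|^α`
(Hölder input of [2], Lemma 2.4); it is NOT proved here — the weight costs a factor `∼ n·ω_n(l_ν)·|l|^α` which the
tail exponents above do not absorb; recorded as a cell GAPS row for a successor.  What IS proved is the unweighted
sum for complex `p′`, which is the input of the contour-shift step for the kernel of `H_k` (the alias phases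
`e^{ilx}` are unimodular, so `sup_strip Σ_l‖h_l‖` bounds the shifted fine-momentum integrand uniformly in `n`).
(ii) The covariance §5 is stated at the side points `Re p′_ν = −π` of the strip only (the form the rectangle
contour uses: the integrand `e^{ip′(x−y)}Σ_l e^{il(x−y)}h_l(p′)` then takes the same values on the two sides, the
family `(h_l)_l` being permuted and `e^{i(p′+l)(x−y)}` depending on `p′ + l` only); no per-`l` periodicity holds and
none is claimed.  (iii) Constants are crude worst-case products; only their dependence on `d`
alone matters; `ζ_2`, `ζ_d` enter through `B4StripSums.zetaC`.  (iv) `U = 1`, `n ≥ 1` arbitrary (`[NeZero n]`), as in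
the whole b05 lineage.
Float cross-check (cell archive `b2b-balaban-b05-g10/num/check163alias.py|.out`, direct evaluation of the regrouped
formulas): the covariance §5 at 6042 side-point comparisons (d ∈ {2,3}, n ∈ {2,3,4}) to 2.5e-13, and the alias sum
`max_{μ,λ} Σ_l|h_l(p′)|` at random strip points SATURATES in `n` (d = 2: 2.36, 2.83, 2.98, 3.03, 3.05, 3.06, 3.06 for
n = 2,…,8; d = 3: 2.71, 3.40, 3.63, 3.71 for n = 2,…,5) — the true constant is O(1), `Msum163` is a crude majorant.
Value = kernel certificate (alias summability + side covariance = the remaining analyticity inputs for the kernel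
of `H_k` via (1.63), cell GAPS row G-b05g10-1 for X10), NOT summit progress.  Unit `b2b-balaban-b05-g10` (B05 cell, generation 10).
-/

noncomputable section

open scoped BigOperators ComplexConjugate Real
open Finset Complex

namespace Literature.MathematicalPhysics.QuantumFieldTheory.Balaban1983to89.B5Hk163Alias

open Literature.MathematicalPhysics.QuantumFieldTheory.Balaban1983to89.B4Strip
open Literature.MathematicalPhysics.QuantumFieldTheory.Balaban1983to89.B4StripCauchy
open Literature.MathematicalPhysics.QuantumFieldTheory.Balaban1983to89.B5Symbol166
open Literature.MathematicalPhysics.QuantumFieldTheory.Balaban1983to89.B5Strip145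
open Literature.MathematicalPhysics.QuantumFieldTheory.Balaban1983to89.B5Symbol166Strip hiding Afac
open Literature.MathematicalPhysics.QuantumFieldTheory.Balaban1983to89.B5Hk163Strip
open Literature.MathematicalPhysics.QuantumFieldTheory.Balaban1983to89.B5Strip145Analytic
open Literature.MathematicalPhysics.QuantumFieldTheory.Balaban1983to89.B4StripSums (omega omega_pos one_le_omega
  omega_zero W one_le_W omega_sq_le_W re_DeltaXi_shift_ge_W v w norm_v_le R norm_R_le norm_R_le_prod CR CR_nonneg
  zetaC zetaC_nonneg sum_omega_rpow_le inv_sq_le_omega inv_W_le_prod_rpow tr_mem_Strip w_add_two_pi v_add_two_pi)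

variable {d : ℕ}

/-! ## §1. Dictionary to the residue-sum engine of `B4StripSums` -/

section Dictionary

variable (n : ℕ) [NeZero n]

omit [NeZero n] in
/-- the geometric-mean leaf `v̄C_μ(p′+l)` IS the one-coordinate factor `v_n(l_μ; p_μ)` of `B4StripSums`. [folklore] -/
theorem vCbar_eq_v (k : Fin d → Fin n) (p : Fin d → ℂ) (μ : Fin d) :
    vCbar n k p μ = v n (k μ : ℕ) (p μ) := by
  unfold vCbar v w
  rw [div_eq_inv_mul, Finset.sum_range (fun s => Complex.exp (-(I * (p μ + 2 * π * ((k μ : ℕ) : ℂ)) / n)) ^ s)]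
  congr 1
  refine Finset.sum_congr rfl (fun j _ => ?_)
  rw [← Complex.exp_nat_mul]
  congr 1
  simp only [shift]
  ring

/-- the regrouped ratio `ρ_l` IS `B4StripSums.R` at `m² = 0`. [folklore] -/
theorem rho_eq_R (k : Fin d → Fin n) (p : Fin d → ℂ) : rho n k p = R n 0 k p := by
  unfold rho R
  by_cases hk : k = fun _ => 0
  · rw [if_pos hk]
  · rw [if_neg hk]

/-- FIRST-POWER ALIAS DECAY of the leaf: `‖v̄C_μ(p′+l)‖ ≤ 12/ω_n(l_μ)` on the fat region. [folklore] -/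
theorem norm_vCbar_le_omega {r : ℝ} (hr : r ≤ 1 / 4) {q : Fin d → ℂ} (hq : q ∈ Fat d r)
    (k : Fin d → Fin n) (μ : Fin d) : ‖vCbar n k q μ‖ ≤ 12 / omega n (k μ) := by
  rw [vCbar_eq_v]
  exact norm_v_le n (k μ) hr (hq μ).1 (hq μ).2

/-- `‖ūC(p′+l)‖ ≤ Π_ν 12/ω_n(l_ν)` on the fat region. [folklore] -/
theorem norm_uCbar_le_prod {r : ℝ} (hr : r ≤ 1 / 4) {q : Fin d → ℂ} (hq : q ∈ Fat d r)
    (k : Fin d → Fin n) : ‖uCbar n k q‖ ≤ ∏ ν, 12 / omega n (k ν) := by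
  unfold uCbar
  rw [norm_prod]
  exact Finset.prod_le_prod (fun ν _ => norm_nonneg _) (fun ν _ => norm_vCbar_le_omega n hr hq k ν)

/-- `‖∂_μ(p′+l)·ūC(p′+l)‖ ≤ 4·Π_{ν ≠ μ} 12/ω_n(l_ν)` on the fat region (no decay in the `μ`-coordinate). [folklore] -/
theorem norm_dC_mul_uCbar_le_prod {r : ℝ} (hr : r ≤ 1 / 4) {q : Fin d → ℂ} (hq : q ∈ Fat d r)
    (k : Fin d → Fin n) (μ : Fin d) :
    ‖dC n k q μ * uCbar n k q‖ ≤ 4 * ∏ ν ∈ univ.erase μ, 12 / omega n (k ν) := by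
  have hP : uCbar n k q = vCbar n k q μ * ∏ ν ∈ univ.erase μ, vCbar n k q ν :=
    (Finset.mul_prod_erase _ _ (Finset.mem_univ μ)).symm
  rw [hP, ← mul_assoc, norm_mul, norm_prod]
  exact mul_le_mul (norm_dC_mul_vCbar_le n hr hq k μ)
    (Finset.prod_le_prod (fun ν _ => norm_nonneg _) (fun ν _ => norm_vCbar_le_omega n hr hq k ν))
    (Finset.prod_nonneg (fun ν _ => norm_nonneg _)) (by norm_num)

/-- SECOND-POWER ALIAS DECAY of `|v_μ(p′+l)|²` continued: `‖u_n(l_μ; p_μ)‖ ≤ 64/ω_n(l_μ)²` on the fat region. [folklore] -/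
theorem norm_uFactor_le_omega {r : ℝ} (hr : r ≤ 1 / 4) {q : Fin d → ℂ} (hq : q ∈ Fat d r)
    (k : Fin d → Fin n) (μ : Fin d) : ‖uFactor n (k μ : ℕ) (q μ)‖ ≤ 64 / omega n (k μ) ^ 2 := by
  have hn : 1 ≤ n := Nat.one_le_iff_ne_zero.mpr (NeZero.ne n)
  by_cases hj : ((k μ : ℕ)) = 0
  · rw [hj, omega_zero n hn]
    have h4 := norm_uFactor_zero_le n hn hr (hq μ).1 (hq μ).2
    linarith
  · have hj1 : 1 ≤ (k μ : ℕ) := Nat.one_le_iff_ne_zero.mpr hj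
    have hjn : (k μ : ℕ) + 1 ≤ n := (k μ).isLt
    exact (norm_uFactor_ne_le n (k μ) hj1 hjn hr (hq μ).1 (hq μ).2).trans (inv_sq_le_omega n (k μ) (k μ).isLt)

/-- the quadratic gain of the regrouped ratio: `‖ρ_l‖ ≤ 16d·(64/7)/W_n(l)`, `l ≠ 0`. [folklore] -/
theorem norm_rho_le_W {r : ℝ} (hr : r ≤ 1 / 4) (hdr : (d : ℝ) * r ^ 2 ≤ 1 / 16) {q : Fin d → ℂ}
    (hq : q ∈ Fat d r) (k : Fin d → Fin n) (hk : k ≠ fun _ => 0) :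
    ‖rho n k q‖ ≤ 16 * d * (64 / 7) / W n k := by
  have h := norm_R_le n 0 le_rfl hr hdr hq k hk
  rw [rho_eq_R]
  simpa using h

/-- the quadratic gain of a shifted denominator: `‖Δ(p′+l)‖⁻¹ ≤ (64/7)/W_n(l)`, `l ≠ 0`. [folklore] -/
theorem inv_norm_DeltaXi_shift_le {r : ℝ} (hr : r ≤ 1 / 4) (hdr : (d : ℝ) * r ^ 2 ≤ 1 / 16)
    {q : Fin d → ℂ} (hq : q ∈ Fat d r) (k : Fin d → Fin n) (hk : k ≠ fun _ => 0) :
    ‖DeltaXi n 0 (shift n k q)‖⁻¹ ≤ 64 / 7 / W n k := by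
  have hW1 := one_le_W n k hk
  have hden : 7 / 64 * W n k ≤ ‖DeltaXi n 0 (shift n k q)‖ :=
    (re_DeltaXi_shift_ge_W n 0 le_rfl hr hdr hq k hk).trans (Complex.re_le_norm _)
  have hpos : 0 < 7 / 64 * W n k := by linarith
  calc ‖DeltaXi n 0 (shift n k q)‖⁻¹ ≤ (7 / 64 * W n k)⁻¹ := inv_anti₀ hpos hden
    _ = 64 / 7 / W n k := by field_simp

end Dictionary

/-! ## §2. The uneven distribution of the quadratic gain over the coordinates -/

section Split

variable (n : ℕ) [NeZero n]

/-- `1/W_n(l) ≤ Π_{ν ≠ μ} ω_n(l_ν)^{−2/d}` (`l ≠ 0`): the whole quadratic gain given to the coordinates OTHER than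
`μ` (the coordinate `μ` gets its decay elsewhere). [folklore] -/
theorem inv_W_le_prod_erase (k : Fin d → Fin n) (hk : k ≠ fun _ => 0) (μ : Fin d) :
    1 / W n k ≤ ∏ ν ∈ univ.erase μ, omega n (k ν) ^ (-(2 : ℝ) / d) := by
  have hW1 := one_le_W n k hk
  have hW0 : 0 < W n k := by linarith
  have hd : 0 < d := Fin.pos μ
  have hdr : (0 : ℝ) < d := by exact_mod_cast hd
  have hcard : (univ.erase μ).card = d - 1 := by
    rw [Finset.card_erase_of_mem (Finset.mem_univ μ), Finset.card_univ, Fintype.card_fin]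
  have hprod : ∏ _ν ∈ univ.erase μ, W n k ^ (-(1 : ℝ) / d) = W n k ^ (-(1 : ℝ) / d * ((d - 1 : ℕ) : ℝ)) := by
    rw [Finset.prod_const, hcard, ← Real.rpow_natCast, ← Real.rpow_mul hW0.le]
  have hexp1 : (-1 : ℝ) ≤ -(1 : ℝ) / d * ((d - 1 : ℕ) : ℝ) := by
    have h1 : ((d - 1 : ℕ) : ℝ) ≤ d := by exact_mod_cast Nat.sub_le d 1
    have h2 : (0 : ℝ) ≤ ((d - 1 : ℕ) : ℝ) := Nat.cast_nonneg _
    rw [show -(1 : ℝ) / d * ((d - 1 : ℕ) : ℝ) = -(((d - 1 : ℕ) : ℝ) / d) by ring]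
    rw [neg_le_neg_iff, div_le_one hdr]
    exact h1
  calc 1 / W n k = W n k ^ (-1 : ℝ) := by rw [Real.rpow_neg_one, one_div]
    _ ≤ W n k ^ (-(1 : ℝ) / d * ((d - 1 : ℕ) : ℝ)) := Real.rpow_le_rpow_of_exponent_le hW1 hexp1
    _ = ∏ _ν ∈ univ.erase μ, W n k ^ (-(1 : ℝ) / d) := hprod.symm
    _ ≤ ∏ ν ∈ univ.erase μ, omega n (k ν) ^ (-(2 : ℝ) / d) := by
        refine Finset.prod_le_prod (fun ν _ => Real.rpow_nonneg hW0.le _) (fun ν _ => ?_)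
        have hω := omega_pos n (k ν) (k ν).isLt
        have hexp : -(1 : ℝ) / d ≤ 0 := div_nonpos_of_nonpos_of_nonneg (by norm_num) hdr.le
        calc W n k ^ (-(1 : ℝ) / d) ≤ (omega n (k ν) ^ 2) ^ (-(1 : ℝ) / d) :=
              Real.rpow_le_rpow_of_nonpos (by positivity) (omega_sq_le_W n k hk ν) hexp
          _ = omega n (k ν) ^ (-(2 : ℝ) / d) := by
              rw [← Real.rpow_natCast, ← Real.rpow_mul hω.le]
              congr 1; push_cast; ring

/-- `1/W_n(l)² ≤ ω_n(l_μ)^{−2}·Π_{ν ≠ μ} ω_n(l_ν)^{−2/d}` (`l ≠ 0`). [folklore] -/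
theorem inv_W_sq_le (k : Fin d → Fin n) (hk : k ≠ fun _ => 0) (μ : Fin d) :
    1 / W n k ^ 2 ≤ (omega n (k μ) ^ 2)⁻¹ * ∏ ν ∈ univ.erase μ, omega n (k ν) ^ (-(2 : ℝ) / d) := by
  have hW1 := one_le_W n k hk
  have hW0 : 0 < W n k := by linarith
  have hω := omega_pos n (k μ) (k μ).isLt
  have h1 : 1 / W n k ≤ (omega n (k μ) ^ 2)⁻¹ := by
    rw [one_div]
    exact inv_anti₀ (by positivity) (omega_sq_le_W n k hk μ)
  have h2 := inv_W_le_prod_erase n k hk μ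
  calc 1 / W n k ^ 2 = (1 / W n k) * (1 / W n k) := by rw [pow_two, one_div_mul_one_div]
    _ ≤ (omega n (k μ) ^ 2)⁻¹ * ∏ ν ∈ univ.erase μ, omega n (k ν) ^ (-(2 : ℝ) / d) :=
        mul_le_mul h1 h2 (by positivity) (by positivity)

omit [NeZero n] in
/-- the product of the two decays of a coordinate: `(12/ω)·ω^{−2/d} = 12·ω^{−(1+2/d)}`. [folklore] -/
theorem div_mul_rpow_eq (j : Fin n) :
    12 / omega n j * omega n j ^ (-(2 : ℝ) / d) = 12 * omega n j ^ (-(1 + 2 / (d : ℝ))) := by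
  have hω := omega_pos n j j.isLt
  rw [div_eq_mul_inv, ← Real.rpow_neg_one, mul_assoc, ← Real.rpow_add hω]
  congr 2
  ring

omit [NeZero n] in
/-- `(ω²)⁻¹ = ω^{−(1+2/2)}` (to sum the `μ`-coordinate with `sum_omega_rpow_le` at `d = 2`). [folklore] -/
theorem inv_sq_eq_rpow (j : Fin n) :
    (omega n j ^ 2)⁻¹ = omega n j ^ (-(1 + 2 / ((2 : ℕ) : ℝ))) := by
  have hω := omega_pos n j j.isLt
  rw [show (-(1 + 2 / ((2 : ℕ) : ℝ))) = -(2 : ℝ) by norm_num, Real.rpow_neg hω.le, Real.rpow_two]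

omit [NeZero n] in
/-- the `n`-UNIFORM coordinate sums: `Σ_j 12 ω_n(j)^{−(1+2/d)} ≤ 24 ζ_d`. [folklore] -/
theorem sum_decay_le (hd : 0 < d) :
    ∑ j : Fin n, 12 * omega n j ^ (-(1 + 2 / (d : ℝ))) ≤ 24 * zetaC d := by
  rw [← Finset.mul_sum]
  have := sum_omega_rpow_le n hd (d := d)
  linarith

omit [NeZero n] in
/-- `Σ_j ω_n(j)^{−2} ≤ 2 ζ_2`, uniformly in `n`. [folklore] -/
theorem sum_inv_sq_le : ∑ j : Fin n, (omega n j ^ 2)⁻¹ ≤ 2 * zetaC 2 := by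
  simp_rw [inv_sq_eq_rpow]
  exact sum_omega_rpow_le n (d := 2) two_pos

end Split

/-! ## §3. Alias-decaying bounds of the head and the tail coefficients -/

section Decay

variable (n : ℕ) [NeZero n]

/-- the constant `c_Ta(d) = 16d(64/7)² + (16d·64/7)²/2` of the first `T`-factor bound. [folklore] -/
def cTa163 (d : ℕ) : ℝ := 16 * d * (64 / 7) ^ 2 + (16 * d * (64 / 7)) ^ 2 / 2

/-- the constant `c_Tb(d) = (8d+1)²·64/7` of the second `T`-factor bound. [folklore] -/
def cTb163 (d : ℕ) : ℝ := (8 * d + 1) ^ 2 * (64 / 7)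

/-- `c_Ta(d) ≥ 0`. [folklore] -/
theorem cTa163_nonneg (d : ℕ) : 0 ≤ cTa163 d := by unfold cTa163; positivity

/-- `c_Tb(d) ≥ 0`. [folklore] -/
theorem cTb163_nonneg (d : ℕ) : 0 ≤ cTb163 d := by unfold cTb163; positivity

/-- DOUBLE QUADRATIC GAIN of `T(l,l′)` in its first slot: `‖T(l,l′)‖ ≤ c_Ta(d)/W_n(l)²` for `l ≠ 0` and every
`l′` (both branches of `Tfac` carry `Δ(p′+l)⁻²`). [folklore] -/
theorem norm_Tfac_le_W_sq {r : ℝ} (hr : r ≤ 1 / 4) (hdr : (d : ℝ) * r ^ 2 ≤ 1 / 16) {q : Fin d → ℂ}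
    (hq : q ∈ Fat d r) (k k' : Fin d → Fin n) (hk : k ≠ fun _ => 0) :
    ‖Tfac n k k' q‖ ≤ cTa163 d / W n k ^ 2 := by
  have hd : (0 : ℝ) ≤ d := Nat.cast_nonneg d
  have hW1 := one_le_W n k hk
  have hW0 : 0 < W n k := by linarith
  have hden : 7 / 64 * W n k ≤ ‖DeltaXi n 0 (shift n k q)‖ :=
    (re_DeltaXi_shift_ge_W n 0 le_rfl hr hdr hq k hk).trans (Complex.re_le_norm _)
  have hΔ0 := norm_DeltaXi0_le n hr hq
  unfold Tfac
  by_cases hk' : k' = fun _ => 0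
  · simp only [hk', if_true]
    have hden2 : (7 / 64 * W n k) ^ 2 ≤ ‖DeltaXi n 0 (shift n k q) ^ 2‖ := by
      rw [norm_pow]
      exact pow_le_pow_left₀ (by positivity) hden 2
    have h := norm_div_le_of hΔ0 (by positivity) hden2
    calc ‖DeltaXi n 0 q / DeltaXi n 0 (shift n k q) ^ 2‖ ≤ 16 * d / (7 / 64 * W n k) ^ 2 := h
      _ = 16 * d * (64 / 7) ^ 2 / W n k ^ 2 := by field_simp
      _ ≤ cTa163 d / W n k ^ 2 := by
          apply div_le_div_of_nonneg_right _ (by positivity)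
          unfold cTa163
          have : (0 : ℝ) ≤ (16 * d * (64 / 7)) ^ 2 / 2 := by positivity
          linarith
  · simp only [hk', if_false]
    have hρ := norm_rho_le_W n hr hdr hq k hk
    have hρ2 : ‖rho n k q ^ 2‖ ≤ (16 * d * (64 / 7) / W n k) ^ 2 := by
      rw [norm_pow]
      exact pow_le_pow_left₀ (norm_nonneg _) hρ 2
    have h := norm_div_le_of hρ2 two_pos (norm_DeltaXi_shift_ge n 0 le_rfl hr hdr hq k' hk')
    calc ‖rho n k q ^ 2 / DeltaXi n 0 (shift n k' q)‖ ≤ (16 * d * (64 / 7) / W n k) ^ 2 / 2 := h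
      _ = (16 * d * (64 / 7)) ^ 2 / 2 / W n k ^ 2 := by field_simp
      _ ≤ cTa163 d / W n k ^ 2 := by
          apply div_le_div_of_nonneg_right _ (by positivity)
          unfold cTa163
          have : (0 : ℝ) ≤ 16 * d * (64 / 7) ^ 2 := by positivity
          linarith

/-- QUADRATIC GAIN of `T(l′,l)` in its second slot: `‖T(l′,l)‖ ≤ c_Tb(d)/W_n(l)` for `l ≠ 0`, every `l′`. [folklore] -/
theorem norm_Tfac_le_W {r : ℝ} (hr : r ≤ 1 / 4) (hdr : (d : ℝ) * r ^ 2 ≤ 1 / 16) {q : Fin d → ℂ}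
    (hq : q ∈ Fat d r) (k k' : Fin d → Fin n) (hk : k ≠ fun _ => 0) :
    ‖Tfac n k' k q‖ ≤ cTb163 d / W n k := by
  have hd : (0 : ℝ) ≤ d := Nat.cast_nonneg d
  have hW1 := one_le_W n k hk
  have hW0 : 0 < W n k := by linarith
  have hinv := inv_norm_DeltaXi_shift_le n hr hdr hq k hk
  have hρ := norm_rho_le n hr hdr hq k'
  have hρ2 : ‖rho n k' q ^ 2‖ ≤ (8 * d + 1) ^ 2 := by
    rw [norm_pow]
    exact pow_le_pow_left₀ (norm_nonneg _) hρ 2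
  unfold Tfac
  rw [if_neg hk, norm_div, div_eq_mul_inv]
  calc ‖rho n k' q ^ 2‖ * ‖DeltaXi n 0 (shift n k q)‖⁻¹ ≤ (8 * d + 1) ^ 2 * (64 / 7 / W n k) :=
        mul_le_mul hρ2 hinv (inv_nonneg.mpr (norm_nonneg _)) (by positivity)
    _ = cTb163 d / W n k := by unfold cTb163; ring

/-- `‖A_{l,l′}‖ ≤ ‖U_{l′}‖·(132·c_Ta/W(l)² + ‖u_n(l_μ;p_μ)‖·c_Tb/W(l))` for `l ≠ 0` (fat region). [folklore] -/
theorem norm_Afac_le_W {r : ℝ} (hr : r ≤ 1 / 4) (hdr : (d : ℝ) * r ^ 2 ≤ 1 / 16) {q : Fin d → ℂ}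
    (hq : q ∈ Fat d r) (μ : Fin d) (k k' : Fin d → Fin n) (hk : k ≠ fun _ => 0) :
    ‖Afac n μ k k' q‖ ≤
      ‖U n k' q‖ * (132 * (cTa163 d / W n k ^ 2) + ‖uFactor n (k μ : ℕ) (q μ)‖ * (cTb163 d / W n k)) := by
  have hT1 := norm_Tfac_le_W_sq n hr hdr hq k k' hk
  have hT2 := norm_Tfac_le_W n hr hdr hq k k' hk
  have hu1 := norm_uFactor_apply_le n hr hq k' μ
  have hW1 := one_le_W n k hk
  have hTa := cTa163_nonneg d
  unfold Afac
  rw [norm_mul]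
  refine mul_le_mul_of_nonneg_left ?_ (norm_nonneg _)
  calc ‖uFactor n (k' μ : ℕ) (q μ) * Tfac n k k' q - uFactor n (k μ : ℕ) (q μ) * Tfac n k' k q‖
      ≤ ‖uFactor n (k' μ : ℕ) (q μ) * Tfac n k k' q‖ + ‖uFactor n (k μ : ℕ) (q μ) * Tfac n k' k q‖ :=
        norm_sub_le _ _
    _ ≤ 132 * (cTa163 d / W n k ^ 2) + ‖uFactor n (k μ : ℕ) (q μ)‖ * (cTb163 d / W n k) := by
        rw [norm_mul, norm_mul]
        exact add_le_add (mul_le_mul hu1 hT1 (norm_nonneg _) (by norm_num))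
          (mul_le_mul_of_nonneg_left hT2 (norm_nonneg _))

/-- `‖Σ_{l′≠l} A_{l,l′}‖ ≤ 132^d·(132·c_Ta/W(l)² + ‖u_n(l_μ;p_μ)‖·c_Tb/W(l))` for `l ≠ 0` (fat region). [folklore] -/
theorem norm_sum_Afac_le_W {r : ℝ} (hr : r ≤ 1 / 4) (hdr : (d : ℝ) * r ^ 2 ≤ 1 / 16) {q : Fin d → ℂ}
    (hq : q ∈ Fat d r) (μ : Fin d) (k : Fin d → Fin n) (hk : k ≠ fun _ => 0) :
    ‖∑ k' ∈ univ.erase k, Afac n μ k k' q‖ ≤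
      132 ^ d * (132 * (cTa163 d / W n k ^ 2) + ‖uFactor n (k μ : ℕ) (q μ)‖ * (cTb163 d / W n k)) := by
  have hW1 := one_le_W n k hk
  have hTa := cTa163_nonneg d
  have hTb := cTb163_nonneg d
  have hB : 0 ≤ 132 * (cTa163 d / W n k ^ 2) + ‖uFactor n (k μ : ℕ) (q μ)‖ * (cTb163 d / W n k) := by
    positivity
  calc ‖∑ k' ∈ univ.erase k, Afac n μ k k' q‖
      ≤ ∑ k' ∈ univ.erase k, ‖Afac n μ k k' q‖ := norm_sum_le _ _
    _ ≤ ∑ k' ∈ univ.erase k, ‖U n k' q‖ *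
          (132 * (cTa163 d / W n k ^ 2) + ‖uFactor n (k μ : ℕ) (q μ)‖ * (cTb163 d / W n k)) :=
        Finset.sum_le_sum (fun k' _ => norm_Afac_le_W n hr hdr hq μ k k' hk)
    _ ≤ ∑ k' : Fin d → Fin n, ‖U n k' q‖ *
          (132 * (cTa163 d / W n k ^ 2) + ‖uFactor n (k μ : ℕ) (q μ)‖ * (cTb163 d / W n k)) :=
        Finset.sum_le_sum_of_subset_of_nonneg (Finset.erase_subset _ _)
          (fun _ _ _ => mul_nonneg (norm_nonneg _) hB)
    _ = (∑ k' : Fin d → Fin n, ‖U n k' q‖) *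
          (132 * (cTa163 d / W n k ^ 2) + ‖uFactor n (k μ : ℕ) (q μ)‖ * (cTb163 d / W n k)) := by
        rw [Finset.sum_mul]
    _ ≤ 132 ^ d * (132 * (cTa163 d / W n k ^ 2) + ‖uFactor n (k μ : ℕ) (q μ)‖ * (cTb163 d / W n k)) :=
        mul_le_mul_of_nonneg_right (sum_norm_U_le n hr hq) hB

/-- the constant `c_A(d) = 132^d (132 c_Ta + 64 c_Tb)` of the decaying alias-sum bound. [folklore] -/
def cA163 (d : ℕ) : ℝ := 132 ^ d * (132 * cTa163 d + 64 * cTb163 d)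

/-- `c_A(d) ≥ 0`. [folklore] -/
theorem cA163_nonneg (d : ℕ) : 0 ≤ cA163 d := by
  unfold cA163; have := cTa163_nonneg d; have := cTb163_nonneg d; positivity

/-- **DECAY OF THE INNER ALIAS SUM**: `‖Σ_{l′≠l} A_{l,l′}‖ ≤ c_A(d)·ω_n(l_μ)^{−2}·Π_{ν≠μ} ω_n(l_ν)^{−2/d}`, `l ≠ 0`,
on the fat region — the two quadratic gains (`W(l)^{−2}`, resp. `|v_μ(p′+l)|² ≲ ω(l_μ)^{−2}` times `W(l)^{−1}`)
distributed unevenly over the coordinates. [folklore] -/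
theorem norm_sum_Afac_le_decay {r : ℝ} (hr : r ≤ 1 / 4) (hdr : (d : ℝ) * r ^ 2 ≤ 1 / 16) {q : Fin d → ℂ}
    (hq : q ∈ Fat d r) (μ : Fin d) (k : Fin d → Fin n) (hk : k ≠ fun _ => 0) :
    ‖∑ k' ∈ univ.erase k, Afac n μ k k' q‖ ≤
      cA163 d * ((omega n (k μ) ^ 2)⁻¹ * ∏ ν ∈ univ.erase μ, omega n (k ν) ^ (-(2 : ℝ) / d)) := by
  set P := (omega n (k μ) ^ 2)⁻¹ * ∏ ν ∈ univ.erase μ, omega n (k ν) ^ (-(2 : ℝ) / d) with hPdef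
  have hW1 := one_le_W n k hk
  have hW0 : 0 < W n k := by linarith
  have hω := omega_pos n (k μ) (k μ).isLt
  have hTa := cTa163_nonneg d
  have hTb := cTb163_nonneg d
  have hQ0 : 0 ≤ ∏ ν ∈ univ.erase μ, omega n (k ν) ^ (-(2 : ℝ) / d) :=
    Finset.prod_nonneg (fun ν _ => Real.rpow_nonneg (omega_pos n (k ν) (k ν).isLt).le _)
  have hP0 : 0 ≤ P := mul_nonneg (by positivity) hQ0
  have h1 : cTa163 d / W n k ^ 2 ≤ cTa163 d * P := by
    rw [div_eq_mul_one_div]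
    exact mul_le_mul_of_nonneg_left (inv_W_sq_le n k hk μ) hTa
  have h2 : ‖uFactor n (k μ : ℕ) (q μ)‖ * (cTb163 d / W n k) ≤ 64 * cTb163 d * P := by
    have hu := norm_uFactor_le_omega n hr hq k μ
    have hs := inv_W_le_prod_erase n k hk μ
    calc ‖uFactor n (k μ : ℕ) (q μ)‖ * (cTb163 d / W n k)
        = ‖uFactor n (k μ : ℕ) (q μ)‖ * (cTb163 d * (1 / W n k)) := by rw [← div_eq_mul_one_div]
      _ ≤ 64 / omega n (k μ) ^ 2 * (cTb163 d * ∏ ν ∈ univ.erase μ, omega n (k ν) ^ (-(2 : ℝ) / d)) :=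
          mul_le_mul hu (mul_le_mul_of_nonneg_left hs hTb) (by positivity) (by positivity)
      _ = 64 * cTb163 d * P := by rw [hPdef]; ring
  calc ‖∑ k' ∈ univ.erase k, Afac n μ k k' q‖
      ≤ 132 ^ d * (132 * (cTa163 d / W n k ^ 2) + ‖uFactor n (k μ : ℕ) (q μ)‖ * (cTb163 d / W n k)) :=
        norm_sum_Afac_le_W n hr hdr hq μ k hk
    _ ≤ 132 ^ d * (132 * (cTa163 d * P) + 64 * cTb163 d * P) := by
        gcongr
    _ = cA163 d * P := by unfold cA163; ring

/-- `‖ρ_l‖ ≤ C_R(d,0)·Π_ν ω_n(l_ν)^{−2/d}` for EVERY `l` (product form of the quadratic gain). [folklore] -/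
theorem norm_rho_le_prod (hd : 0 < d) {r : ℝ} (hr : r ≤ 1 / 4) (hdr : (d : ℝ) * r ^ 2 ≤ 1 / 16)
    {q : Fin d → ℂ} (hq : q ∈ Fat d r) (k : Fin d → Fin n) :
    ‖rho n k q‖ ≤ CR d 0 * ∏ ν, omega n (k ν) ^ (-(2 : ℝ) / d) := by
  rw [rho_eq_R]
  exact norm_R_le_prod n hd 0 le_rfl hr hdr hq k

/-- the constant `c_head(d) = 2 C_R(d,0)/c_Y(d)` of the decaying head bound. [folklore] -/
def cHead163 (d : ℕ) : ℝ := 2 * CR d 0 / cY163 d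

/-- `c_head(d) ≥ 0`. [folklore] -/
theorem cHead163_nonneg (d : ℕ) : 0 ≤ cHead163 d := by
  unfold cHead163; have := CR_nonneg d (le_refl (0 : ℝ)); have := cY163_pos d; positivity

/-- **DECAYING HEAD BOUND**: `‖headC_l‖ ≤ c_head(d)·Π_ν (12/ω_n(l_ν))·ω_n(l_ν)^{−2/d}` on the zero-free strip,
every `l` and every `n`. [folklore] -/
theorem norm_headC_le_decay {κ : ℝ} (hκ0 : 0 ≤ κ) (hκ : κ ≤ kappa163 d) {p : Fin d → ℂ}
    (hp : p ∈ Strip d κ) (μ : Fin d) (k : Fin d → Fin n) :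
    ‖headC n μ k p‖ ≤ cHead163 d * ∏ ν, (12 / omega n (k ν) * omega n (k ν) ^ (-(2 : ℝ) / d)) := by
  have hd : 0 < d := Fin.pos μ
  have hr := rOf_le d
  have hdr := d_mul_rOf_sq_le d
  have hq : p ∈ Fat d (rOf d) := strip_subset_fat (rOf_pos d).le (hκ.trans (kappa163_le_rOf d)) hp
  have hY := Yc_lower n hκ0 (hκ.trans (kappa163_le_kappaY d)) μ p hp
  have hCR := CR_nonneg d (le_refl (0 : ℝ))
  have hA0 : 0 ≤ ∏ ν, 12 / omega n (k ν) :=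
    Finset.prod_nonneg (fun ν _ => div_nonneg (by norm_num) (omega_pos n (k ν) (k ν).isLt).le)
  have hB0 : 0 ≤ ∏ ν, omega n (k ν) ^ (-(2 : ℝ) / d) :=
    Finset.prod_nonneg (fun ν _ => Real.rpow_nonneg (omega_pos n (k ν) (k ν).isLt).le _)
  have h1 := norm_uCbar_le_prod n hr hq k
  have h2 := norm_vCbar_le n hr hq k μ
  have h3 := norm_rho_le_prod n hd hr hdr hq k
  unfold headC
  calc ‖uCbar n k p * vCbar n k p μ * rho n k p / Yc n μ p‖
      ≤ (∏ ν, 12 / omega n (k ν)) * 2 * (CR d 0 * ∏ ν, omega n (k ν) ^ (-(2 : ℝ) / d)) / cY163 d := by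
        refine norm_div_le_of ?_ (cY163_pos d) hY
        rw [norm_mul, norm_mul]
        exact mul_le_mul (mul_le_mul h1 h2 (norm_nonneg _) hA0) h3 (norm_nonneg _) (by positivity)
    _ = cHead163 d * ((∏ ν, 12 / omega n (k ν)) * ∏ ν, omega n (k ν) ^ (-(2 : ℝ) / d)) := by
        unfold cHead163; ring
    _ = cHead163 d * ∏ ν, (12 / omega n (k ν) * omega n (k ν) ^ (-(2 : ℝ) / d)) := by
        rw [Finset.prod_mul_distrib]

/-- the constant `c_tail(d) = 4 c_A/c_N · (2B_c²)^d/(c_Y c_F)` of the decaying tail bound. [folklore] -/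
def cTail163 (d : ℕ) : ℝ := 4 * cA163 d / cN163 d * ((2 * Bc d ^ 2) ^ d / (cY163 d * cF163 d))

/-- `c_tail(d) ≥ 0`. [folklore] -/
theorem cTail163_nonneg (d : ℕ) : 0 ≤ cTail163 d := by
  unfold cTail163
  have := cA163_nonneg d; have := cN163_pos d; have := cY163_pos d; have := cF163_pos d
  positivity

/-- **DECAYING TAIL BOUND**: `‖tailC_l‖ ≤ c_tail(d)·ω_n(l_μ)^{−2}·Π_{ν≠μ} (12/ω_n(l_ν))·ω_n(l_ν)^{−2/d}` on the
zero-free strip, `l ≠ 0`, every `n`. [folklore] -/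
theorem norm_tailC_le_decay {κ : ℝ} (hκ0 : 0 ≤ κ) (hκ : κ ≤ kappa163 d) {p : Fin d → ℂ}
    (hp : p ∈ Strip d κ) (μ : Fin d) (k : Fin d → Fin n) (hk : k ≠ fun _ => 0) :
    ‖tailC n μ k p‖ ≤ cTail163 d * ((omega n (k μ) ^ 2)⁻¹ *
      ∏ ν ∈ univ.erase μ, (12 / omega n (k ν) * omega n (k ν) ^ (-(2 : ℝ) / d))) := by
  have hr := rOf_le d
  have hdr := d_mul_rOf_sq_le d
  have hq : p ∈ Fat d (rOf d) := strip_subset_fat (rOf_pos d).le (hκ.trans (kappa163_le_rOf d)) hp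
  obtain ⟨hF, hN, hY, _⟩ := denominators_lower n hκ0 hκ hp
  have hB := one_le_Bc d
  have hcA := cA163_nonneg d
  have hω := omega_pos n (k μ) (k μ).isLt
  have hA0 : 0 ≤ ∏ ν ∈ univ.erase μ, 12 / omega n (k ν) :=
    Finset.prod_nonneg (fun ν _ => div_nonneg (by norm_num) (omega_pos n (k ν) (k ν).isLt).le)
  have hQ0 : 0 ≤ ∏ ν ∈ univ.erase μ, omega n (k ν) ^ (-(2 : ℝ) / d) :=
    Finset.prod_nonneg (fun ν _ => Real.rpow_nonneg (omega_pos n (k ν) (k ν).isLt).le _)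
  have h1 := norm_dC_mul_uCbar_le_prod n hr hq k μ
  have h2 := norm_sum_Afac_le_decay n hr hdr hq μ k hk
  unfold tailC
  rw [norm_mul]
  calc ‖dC n k p μ * uCbar n k p * (∑ k' ∈ univ.erase k, Afac n μ k k' p) / Ncal n p‖ *
        ‖(∏ ν, Yc n ν p) / (Yc n μ p * F66 n p)‖
      ≤ (4 * ∏ ν ∈ univ.erase μ, 12 / omega n (k ν)) *
          (cA163 d * ((omega n (k μ) ^ 2)⁻¹ * ∏ ν ∈ univ.erase μ, omega n (k ν) ^ (-(2 : ℝ) / d))) /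
          cN163 d * ((2 * Bc d ^ 2) ^ d / (cY163 d * cF163 d)) := by
        refine mul_le_mul ?_ ?_ (norm_nonneg _) (by have := cN163_pos d; positivity)
        · refine norm_div_le_of ?_ (cN163_pos d) hN
          rw [norm_mul]
          exact mul_le_mul h1 h2 (norm_nonneg _) (by positivity)
        · refine norm_div_le_of ?_ (mul_pos (cY163_pos d) (cF163_pos d)) ?_
          · exact norm_prod_le_pow _ _ (by nlinarith) (by simp) (fun ν _ => norm_Yc_le n hr hdr hq ν)
          · rw [norm_mul]
            exact mul_le_mul (hY μ) hF (cF163_pos d).le (norm_nonneg _)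
    _ = cTail163 d * ((omega n (k μ) ^ 2)⁻¹ * ((∏ ν ∈ univ.erase μ, 12 / omega n (k ν)) *
          ∏ ν ∈ univ.erase μ, omega n (k ν) ^ (-(2 : ℝ) / d))) := by
        unfold cTail163; ring
    _ = cTail163 d * ((omega n (k μ) ^ 2)⁻¹ *
          ∏ ν ∈ univ.erase μ, (12 / omega n (k ν) * omega n (k ν) ^ (-(2 : ℝ) / d))) := by
        rw [Finset.prod_mul_distrib]

end Decay

/-! ## §4. The `n`-uniform alias sums -/

section AliasSums

variable (n : ℕ) [NeZero n]

omit [NeZero n] in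
/-- `Σ_l Π_ν (12/ω_n(l_ν))·ω_n(l_ν)^{−2/d} ≤ (24 ζ_d)^d`, uniformly in `n`. [folklore] -/
theorem sum_prod_decay_le (hd : 0 < d) :
    ∑ k : Fin d → Fin n, ∏ ν, (12 / omega n (k ν) * omega n (k ν) ^ (-(2 : ℝ) / d)) ≤ (24 * zetaC d) ^ d := by
  have h := Finset.prod_univ_sum (fun _ : Fin d => (Finset.univ : Finset (Fin n)))
    (fun _ j => 12 / omega n (j : ℕ) * omega n (j : ℕ) ^ (-(2 : ℝ) / d))
  rw [Fintype.piFinset_univ] at h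
  rw [← h]
  have hS : ∑ j : Fin n, 12 / omega n (j : ℕ) * omega n (j : ℕ) ^ (-(2 : ℝ) / d) ≤ 24 * zetaC d := by
    simp_rw [div_mul_rpow_eq]
    exact sum_decay_le n hd
  have hS0 : 0 ≤ ∑ j : Fin n, 12 / omega n (j : ℕ) * omega n (j : ℕ) ^ (-(2 : ℝ) / d) :=
    Finset.sum_nonneg (fun j _ => mul_nonneg (div_nonneg (by norm_num) (omega_pos n j j.isLt).le)
      (Real.rpow_nonneg (omega_pos n j j.isLt).le _))
  calc ∏ _ν : Fin d, ∑ j : Fin n, 12 / omega n (j : ℕ) * omega n (j : ℕ) ^ (-(2 : ℝ) / d)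
      ≤ ∏ _ν : Fin d, (24 * zetaC d) := Finset.prod_le_prod (fun _ _ => hS0) (fun _ _ => hS)
    _ = (24 * zetaC d) ^ d := by simp

omit [NeZero n] in
/-- `Σ_l ω_n(l_μ)^{−2}·Π_{ν≠μ} (12/ω_n(l_ν))·ω_n(l_ν)^{−2/d} ≤ 2ζ_2·(24 ζ_d)^{d−1}`, uniformly in `n`
(the mixed product summed coordinate by coordinate). [folklore] -/
theorem sum_mixed_decay_le (hd : 0 < d) (μ : Fin d) :
    ∑ k : Fin d → Fin n, (omega n (k μ) ^ 2)⁻¹ *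
        ∏ ν ∈ univ.erase μ, (12 / omega n (k ν) * omega n (k ν) ^ (-(2 : ℝ) / d))
      ≤ 2 * zetaC 2 * (24 * zetaC d) ^ (d - 1) := by
  classical
  -- the coordinatewise weights
  set F : Fin d → Fin n → ℝ := fun ν j =>
    if ν = μ then (omega n (j : ℕ) ^ 2)⁻¹ else 12 / omega n (j : ℕ) * omega n (j : ℕ) ^ (-(2 : ℝ) / d)
    with hFdef
  have hterm : ∀ k : Fin d → Fin n, (omega n (k μ) ^ 2)⁻¹ *
      ∏ ν ∈ univ.erase μ, (12 / omega n (k ν) * omega n (k ν) ^ (-(2 : ℝ) / d)) = ∏ ν, F ν (k ν) := by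
    intro k
    rw [← Finset.mul_prod_erase _ _ (Finset.mem_univ μ)]
    congr 1
    · simp [hFdef]
    · refine Finset.prod_congr rfl (fun ν hν => ?_)
      simp [hFdef, Finset.ne_of_mem_erase hν]
  simp_rw [hterm]
  have h := Finset.prod_univ_sum (fun _ : Fin d => (Finset.univ : Finset (Fin n))) (fun ν j => F ν j)
  rw [Fintype.piFinset_univ] at h
  rw [← h]
  have hF0 : ∀ ν j, 0 ≤ F ν j := by
    intro ν j
    by_cases hν : ν = μ
    · simp only [hFdef, hν, if_true]
      have := omega_pos n j j.isLt
      positivity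
    · simp only [hFdef, hν, if_false]
      exact mul_nonneg (div_nonneg (by norm_num) (omega_pos n j j.isLt).le)
        (Real.rpow_nonneg (omega_pos n j j.isLt).le _)
  have hS0 : ∀ ν, 0 ≤ ∑ j : Fin n, F ν j := fun ν => Finset.sum_nonneg (fun j _ => hF0 ν j)
  have hSμ : ∑ j : Fin n, F μ j ≤ 2 * zetaC 2 := by
    simp only [hFdef, if_true]
    exact sum_inv_sq_le n
  have hSν : ∀ ν, ν ≠ μ → ∑ j : Fin n, F ν j ≤ 24 * zetaC d := by
    intro ν hν
    simp only [hFdef, hν, if_false]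
    simp_rw [div_mul_rpow_eq]
    exact sum_decay_le n hd
  have hz := zetaC_nonneg d
  rw [← Finset.mul_prod_erase _ _ (Finset.mem_univ μ)]
  have hcard : (univ.erase μ).card = d - 1 := by
    rw [Finset.card_erase_of_mem (Finset.mem_univ μ), Finset.card_univ, Fintype.card_fin]
  calc (∑ j : Fin n, F μ j) * ∏ ν ∈ univ.erase μ, ∑ j : Fin n, F ν j
      ≤ (2 * zetaC 2) * ∏ _ν ∈ univ.erase μ, (24 * zetaC d) :=
        mul_le_mul hSμ (Finset.prod_le_prod (fun ν _ => hS0 ν)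
          (fun ν hν => hSν ν (Finset.ne_of_mem_erase hν)))
          (Finset.prod_nonneg (fun ν _ => hS0 ν)) (by have := zetaC_nonneg 2; positivity)
    _ = 2 * zetaC 2 * (24 * zetaC d) ^ (d - 1) := by rw [Finset.prod_const, hcard]

/-- the `n`-uniform bound `S_head(d) = c_head(d)(24ζ_d)^d` of `Σ_l ‖headC_l‖`. [folklore] -/
def Shead163 (d : ℕ) : ℝ := cHead163 d * (24 * zetaC d) ^ d

/-- the `n`-uniform bound `S_tail(d) = M_tail(d) + c_tail(d)·2ζ_2(24ζ_d)^{d−1}` of `Σ_l ‖tailC_l‖`. [folklore] -/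
def Stail163 (d : ℕ) : ℝ := Mtail163 d + cTail163 d * (2 * zetaC 2 * (24 * zetaC d) ^ (d - 1))

/-- the `n`-uniform bound `S₁₆₃(d) = S_head + S_tail·M_g` of the alias sum `Σ_l ‖h_{l;μλ}(p′)‖`. [folklore] -/
def Msum163 (d : ℕ) : ℝ := Shead163 d + Stail163 d * Mg163 d

/-- `S_head(d) ≥ 0`. [folklore] -/
theorem Shead163_nonneg (d : ℕ) : 0 ≤ Shead163 d := by
  unfold Shead163; have := cHead163_nonneg d; have := zetaC_nonneg d; positivity

/-- `S_tail(d) ≥ 0`. [folklore] -/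
theorem Stail163_nonneg (d : ℕ) : 0 ≤ Stail163 d := by
  unfold Stail163
  have := Mtail163_nonneg d; have := cTail163_nonneg d; have := zetaC_nonneg d; have := zetaC_nonneg 2
  positivity

/-- **`Σ_l ‖headC_l(p′)‖ ≤ S_head(d)`** on the zero-free strip, uniformly in `n`. [folklore] -/
theorem sum_norm_headC_le {κ : ℝ} (hκ0 : 0 ≤ κ) (hκ : κ ≤ kappa163 d) {p : Fin d → ℂ}
    (hp : p ∈ Strip d κ) (μ : Fin d) : ∑ k : Fin d → Fin n, ‖headC n μ k p‖ ≤ Shead163 d := by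
  have hd : 0 < d := Fin.pos μ
  have hc := cHead163_nonneg d
  calc ∑ k : Fin d → Fin n, ‖headC n μ k p‖
      ≤ ∑ k : Fin d → Fin n, cHead163 d * ∏ ν, (12 / omega n (k ν) * omega n (k ν) ^ (-(2 : ℝ) / d)) :=
        Finset.sum_le_sum (fun k _ => norm_headC_le_decay n hκ0 hκ hp μ k)
    _ = cHead163 d * ∑ k : Fin d → Fin n, ∏ ν, (12 / omega n (k ν) * omega n (k ν) ^ (-(2 : ℝ) / d)) := by
        rw [Finset.mul_sum]
    _ ≤ cHead163 d * (24 * zetaC d) ^ d := mul_le_mul_of_nonneg_left (sum_prod_decay_le n hd) hc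

/-- **`Σ_l ‖tailC_l(p′)‖ ≤ S_tail(d)`** on the zero-free strip, uniformly in `n` (`l = 0` by the uniform bound
`M_tail`, `l ≠ 0` by the decaying bound). [folklore] -/
theorem sum_norm_tailC_le {κ : ℝ} (hκ0 : 0 ≤ κ) (hκ : κ ≤ kappa163 d) {p : Fin d → ℂ}
    (hp : p ∈ Strip d κ) (μ : Fin d) : ∑ k : Fin d → Fin n, ‖tailC n μ k p‖ ≤ Stail163 d := by
  classical
  have hd : 0 < d := Fin.pos μ
  have hc := cTail163_nonneg d
  set g : (Fin d → Fin n) → ℝ := fun k => (omega n (k μ) ^ 2)⁻¹ *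
      ∏ ν ∈ univ.erase μ, (12 / omega n (k ν) * omega n (k ν) ^ (-(2 : ℝ) / d)) with hgdef
  have hg0 : ∀ k, 0 ≤ g k := by
    intro k
    have := omega_pos n (k μ) (k μ).isLt
    exact mul_nonneg (by positivity) (Finset.prod_nonneg (fun ν _ => mul_nonneg
      (div_nonneg (by norm_num) (omega_pos n (k ν) (k ν).isLt).le) (Real.rpow_nonneg (omega_pos n (k ν) (k ν).isLt).le _)))
  have hbd : ∀ k : Fin d → Fin n, ‖tailC n μ k p‖ ≤
      (if k = (fun _ => 0) then Mtail163 d else 0) + cTail163 d * g k := by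
    intro k
    by_cases hk : k = fun _ => 0
    · rw [if_pos hk]
      have h1 := norm_tailC_le n hκ0 hκ hp μ k
      have h2 : 0 ≤ cTail163 d * g k := mul_nonneg hc (hg0 k)
      linarith
    · rw [if_neg hk, zero_add]
      exact norm_tailC_le_decay n hκ0 hκ hp μ k hk
  calc ∑ k : Fin d → Fin n, ‖tailC n μ k p‖
      ≤ ∑ k : Fin d → Fin n, ((if k = (fun _ => 0) then Mtail163 d else 0) + cTail163 d * g k) :=
        Finset.sum_le_sum (fun k _ => hbd k)
    _ = Mtail163 d + cTail163 d * ∑ k : Fin d → Fin n, g k := by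
        rw [Finset.sum_add_distrib, Finset.sum_ite_eq' Finset.univ (fun _ => (0 : Fin n)), if_pos (Finset.mem_univ _),
          Finset.mul_sum]
    _ ≤ Mtail163 d + cTail163 d * (2 * zetaC 2 * (24 * zetaC d) ^ (d - 1)) := by
        have := sum_mixed_decay_le n hd μ
        gcongr

/-- **THE `n`-UNIFORM ALIAS-SUM BOUND OF THE CONTINUED (1.63) MULTIPLIER**:
`Σ_{l} ‖h_{l;μλ}(p′)‖ ≤ S₁₆₃(d)` for `p′ ∈ Strip d κ`, `0 ≤ κ ≤ κ₁₆₃(d)`, EVERY `n ≥ 1` and every `μ, λ`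
(the sum over all `n^d` alias representatives `l ∈ 2π{0,…,n−1}^d`). [folklore] -/
theorem sum_norm_h163_le {κ : ℝ} (hκ0 : 0 ≤ κ) (hκ : κ ≤ kappa163 d) {p : Fin d → ℂ}
    (hp : p ∈ Strip d κ) (μ lam : Fin d) :
    ∑ k : Fin d → Fin n, ‖h163 n μ lam k p‖ ≤ Msum163 d := by
  have hH := sum_norm_headC_le n hκ0 hκ hp μ
  have hT := sum_norm_tailC_le n hκ0 hκ hp μ
  have hg := norm_gdir_le n hκ0 hκ hp lam
  have hSh := Shead163_nonneg d
  have hMg : 0 ≤ Mg163 d := (norm_nonneg _).trans hg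
  have hterm : ∀ k : Fin d → Fin n, ‖h163 n μ lam k p‖ ≤ ‖headC n μ k p‖ + ‖tailC n μ k p‖ * Mg163 d := by
    intro k
    unfold h163
    refine (norm_add_le _ _).trans (add_le_add ?_ ?_)
    · by_cases hlm : lam = μ
      · simp only [hlm, if_true]; exact le_rfl
      · simp only [hlm, if_false, norm_zero]; exact norm_nonneg _
    · rw [norm_mul]
      exact mul_le_mul_of_nonneg_left hg (norm_nonneg _)
  calc ∑ k : Fin d → Fin n, ‖h163 n μ lam k p‖
      ≤ ∑ k : Fin d → Fin n, (‖headC n μ k p‖ + ‖tailC n μ k p‖ * Mg163 d) :=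
        Finset.sum_le_sum (fun k _ => hterm k)
    _ = (∑ k : Fin d → Fin n, ‖headC n μ k p‖) + (∑ k : Fin d → Fin n, ‖tailC n μ k p‖) * Mg163 d := by
        rw [Finset.sum_add_distrib, Finset.sum_mul]
    _ ≤ Shead163 d + Stail163 d * Mg163 d :=
        add_le_add hH (mul_le_mul_of_nonneg_right hT hMg)

end AliasSums

/-! ## §5. The alias re-indexing covariance across the strip sides -/

section Covariance

variable (n : ℕ) [NeZero n]

omit [NeZero n] in
/-- the fine phase `e^{iη(p′_μ+l_μ)}` is the inverse of `B4StripSums.w`. [folklore] -/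
theorem exp_shift_eq_inv_w (k : Fin d → Fin n) (p : Fin d → ℂ) (μ : Fin d) :
    Complex.exp (shift n k p μ / n * I) = (w n (k μ : ℕ) (p μ))⁻¹ := by
  rw [w, ← Complex.exp_neg]
  congr 1
  simp only [shift, neg_neg]
  ring

/-- RE-INDEXING OF THE LEAF `v̄C`: `v̄C_μ(l; p′ + 2πe_ν) = v̄C_μ(σ_ν l; p′)` (no side condition). [folklore] -/
theorem vCbar_tr (k : Fin d → Fin n) (p : Fin d → ℂ) (ν μ : Fin d) :
    vCbar n k (tr p ν) μ = vCbar n (sigma n ν k) p μ := by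
  rw [vCbar_eq_v, vCbar_eq_v]
  by_cases h : μ = ν
  · subst h
    rw [tr_apply_self, sigma_apply_self, val_add_one_eq_mod]
    exact v_add_two_pi n (k μ) (NeZero.ne n) (p μ)
  · rw [tr_apply_of_ne h, sigma_apply_of_ne n h]

/-- RE-INDEXING OF `ūC`: `ūC(l; p′ + 2πe_ν) = ūC(σ_ν l; p′)`. [folklore] -/
theorem uCbar_tr (k : Fin d → Fin n) (p : Fin d → ℂ) (ν : Fin d) :
    uCbar n k (tr p ν) = uCbar n (sigma n ν k) p := by
  unfold uCbar
  exact Finset.prod_congr rfl (fun μ _ => vCbar_tr n k p ν μ)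

/-- RE-INDEXING OF `∂_μ(p′+l)`: `∂_μ(l; p′ + 2πe_ν) = ∂_μ(σ_ν l; p′)`. [folklore] -/
theorem dC_tr (k : Fin d → Fin n) (p : Fin d → ℂ) (ν μ : Fin d) :
    dC n k (tr p ν) μ = dC n (sigma n ν k) p μ := by
  unfold dC
  rw [exp_shift_eq_inv_w, exp_shift_eq_inv_w]
  congr 3
  by_cases h : μ = ν
  · subst h
    rw [tr_apply_self, sigma_apply_self, val_add_one_eq_mod]
    exact w_add_two_pi n (k μ) (NeZero.ne n) (p μ)
  · rw [tr_apply_of_ne h, sigma_apply_of_ne n h]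

omit [NeZero n] in
/-- the direction factor is `2π`-periodic: `\overline{∂¹_λ}(p′ + 2πe_ν) = \overline{∂¹_λ}(p′)`. [folklore] -/
theorem expFacNeg_tr (lam ν : Fin d) (p : Fin d → ℂ) : expFacNeg lam (tr p ν) = expFacNeg lam p := by
  rw [tr_def]
  exact expFacNeg_periodic lam ν p

/-- the generic formula `ρ_l = Δ(p′)/Δ(p′+l)` for EVERY `l` once `Δ(p′) ≠ 0`. [folklore] -/
theorem rho_eq_div {q : Fin d → ℂ} (hq : DeltaXi n 0 q ≠ 0) (k : Fin d → Fin n) :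
    rho n k q = DeltaXi n 0 q / DeltaXi n 0 (shift n k q) := by
  unfold rho
  by_cases hk : k = fun _ => 0
  · rw [if_pos hk, hk, shift_zero, div_self hq]
  · rw [if_neg hk]

/-- the generic formula `T(l,l′) = Δ(p′)²/(Δ(p′+l)²Δ(p′+l′))` for EVERY `l, l′` once `Δ(p′) ≠ 0` (the symbolic
cancellations of `Tfac` undone). [folklore] -/
theorem Tfac_eq_div {q : Fin d → ℂ} (hq : DeltaXi n 0 q ≠ 0) (k k' : Fin d → Fin n) :
    Tfac n k k' q = DeltaXi n 0 q ^ 2 / (DeltaXi n 0 (shift n k q) ^ 2 * DeltaXi n 0 (shift n k' q)) := by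
  unfold Tfac
  by_cases hk' : k' = fun _ => 0
  · rw [if_pos hk', hk', shift_zero, pow_two (DeltaXi n 0 q), mul_div_mul_right _ _ hq]
  · rw [if_neg hk', rho_eq_div n hq, div_pow, div_div]

/-- THE SHIFT LAW OF `ρ`: `ρ_l(p′ + 2πe_ν)·Δ(p′) = ρ_{σ_ν l}(p′)·Δ(p′ + 2πe_ν)`. [folklore] -/
theorem rho_tr_mul (k : Fin d → Fin n) {p : Fin d → ℂ} (ν : Fin d) (h0 : DeltaXi n 0 p ≠ 0)
    (h1 : DeltaXi n 0 (tr p ν) ≠ 0) :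
    rho n k (tr p ν) * DeltaXi n 0 p = rho n (sigma n ν k) p * DeltaXi n 0 (tr p ν) := by
  rw [rho_eq_div n h1, rho_eq_div n h0, DeltaXi_shift_tr]
  ring

/-- THE SHIFT LAW OF `T`: `T_{l,l′}(p′ + 2πe_ν)·Δ(p′)² = T_{σl,σl′}(p′)·Δ(p′ + 2πe_ν)²`. [folklore] -/
theorem Tfac_tr_mul (k k' : Fin d → Fin n) {p : Fin d → ℂ} (ν : Fin d) (h0 : DeltaXi n 0 p ≠ 0)
    (h1 : DeltaXi n 0 (tr p ν) ≠ 0) :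
    Tfac n k k' (tr p ν) * DeltaXi n 0 p ^ 2 =
      Tfac n (sigma n ν k) (sigma n ν k') p * DeltaXi n 0 (tr p ν) ^ 2 := by
  rw [Tfac_eq_div n h1, Tfac_eq_div n h0, DeltaXi_shift_tr, DeltaXi_shift_tr]
  ring

/-- THE SHIFT LAW OF THE ALIAS SUMMAND: `A_{l,l′}(p′ + 2πe_ν)·Δ(p′)² = A_{σl,σl′}(p′)·Δ(p′ + 2πe_ν)²`
(`p′_ν ∉ {0, −2π}`). [folklore] -/
theorem Afac_tr_mul (μ : Fin d) (k k' : Fin d → Fin n) {p : Fin d → ℂ} (ν : Fin d) (hz : p ν ≠ 0)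
    (hz' : p ν + 2 * Real.pi ≠ 0) (h0 : DeltaXi n 0 p ≠ 0) (h1 : DeltaXi n 0 (tr p ν) ≠ 0) :
    Afac n μ k k' (tr p ν) * DeltaXi n 0 p ^ 2 =
      Afac n μ (sigma n ν k) (sigma n ν k') p * DeltaXi n 0 (tr p ν) ^ 2 := by
  unfold Afac
  rw [U_tr n k' p ν hz hz', uFactor_coord_tr n k' p ν μ hz hz', uFactor_coord_tr n k p ν μ hz hz',
    Tfac_eq_div n h1, Tfac_eq_div n h1, Tfac_eq_div n h0, Tfac_eq_div n h0, DeltaXi_shift_tr, DeltaXi_shift_tr]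
  ring

/-- THE SHIFT LAW OF THE INNER ALIAS SUM (re-indexed by the bijection `σ_ν`):
`(Σ_{l′≠l} A_{l,l′})(p′ + 2πe_ν)·Δ(p′)² = (Σ_{l′≠σl} A_{σl,l′})(p′)·Δ(p′ + 2πe_ν)²`. [folklore] -/
theorem sum_Afac_tr_mul (μ : Fin d) (k : Fin d → Fin n) {p : Fin d → ℂ} (ν : Fin d) (hz : p ν ≠ 0)
    (hz' : p ν + 2 * Real.pi ≠ 0) (h0 : DeltaXi n 0 p ≠ 0) (h1 : DeltaXi n 0 (tr p ν) ≠ 0) :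
    (∑ k' ∈ univ.erase k, Afac n μ k k' (tr p ν)) * DeltaXi n 0 p ^ 2 =
      (∑ k' ∈ univ.erase (sigma n ν k), Afac n μ (sigma n ν k) k' p) * DeltaXi n 0 (tr p ν) ^ 2 := by
  rw [Finset.sum_erase_eq_sub (Finset.mem_univ k), Finset.sum_erase_eq_sub (Finset.mem_univ _), sub_mul,
    sub_mul, Finset.sum_mul, Finset.sum_mul]
  have hre : ∑ k' : Fin d → Fin n, Afac n μ (sigma n ν k) (sigma n ν k') p * DeltaXi n 0 (tr p ν) ^ 2 =
      ∑ k' : Fin d → Fin n, Afac n μ (sigma n ν k) k' p * DeltaXi n 0 (tr p ν) ^ 2 :=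
    Equiv.sum_comp (sigmaEquiv n ν) (fun k' => Afac n μ (sigma n ν k) k' p * DeltaXi n 0 (tr p ν) ^ 2)
  rw [← hre]
  simp_rw [Afac_tr_mul n μ k _ ν hz hz' h0 h1]

/-- **RE-INDEXING COVARIANCE OF THE HEAD COEFFICIENT** across the strip side `Re p′_ν = −π`:
`headC_l(p′ + 2πe_ν) = headC_{σ_ν l}(p′)`. [folklore] -/
theorem headC_tr {κ : ℝ} (hκ0 : 0 ≤ κ) (hκ : κ ≤ kappa163 d) {p : Fin d → ℂ} (hp : p ∈ Strip d κ)
    (ν : Fin d) (hre : (p ν).re = -Real.pi) (μ : Fin d) (k : Fin d → Fin n) :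
    headC n μ k (tr p ν) = headC n μ (sigma n ν k) p := by
  obtain ⟨hκ1, hdκ⟩ := kappa_small hκ0 (hκ.trans (kappa163_le_rOf d))
  obtain ⟨hz, hz', h0, h1⟩ := edge_conditions n hκ1 hdκ hp ν hre
  have hpt : tr p ν ∈ Strip d κ := tr_mem_Strip hp ν hre
  obtain ⟨_, _, hYp, _⟩ := denominators_ne_zero n hκ0 hκ hp
  obtain ⟨_, _, hYt, _⟩ := denominators_ne_zero n hκ0 hκ hpt
  have Hρ := rho_tr_mul n k ν h0 h1
  have HY := Yc_tr_mul n μ p ν hz hz' h0 h1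
  unfold headC
  rw [uCbar_tr, vCbar_tr, div_eq_div_iff (hYt μ) (hYp μ)]
  apply mul_right_cancel₀ h0
  linear_combination (uCbar n (sigma n ν k) p * vCbar n (sigma n ν k) p μ * Yc n μ p) * Hρ -
    (uCbar n (sigma n ν k) p * vCbar n (sigma n ν k) p μ * rho n (sigma n ν k) p) * HY

/-- **RE-INDEXING COVARIANCE OF THE TAIL** across the strip side `Re p′_ν = −π`:
`(tailC_l·gdir_λ)(p′ + 2πe_ν) = (tailC_{σ_ν l}·gdir_λ)(p′)` (`tailC` alone picks up `Δ(p′+2πe_ν)/Δ(p′)`,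
`gdir_λ` its inverse). [folklore] -/
theorem tailC_mul_gdir_tr {κ : ℝ} (hκ0 : 0 ≤ κ) (hκ : κ ≤ kappa163 d) {p : Fin d → ℂ} (hp : p ∈ Strip d κ)
    (ν : Fin d) (hre : (p ν).re = -Real.pi) (μ lam : Fin d) (k : Fin d → Fin n) :
    tailC n μ k (tr p ν) * gdir n lam (tr p ν) = tailC n μ (sigma n ν k) p * gdir n lam p := by
  obtain ⟨hκ1, hdκ⟩ := kappa_small hκ0 (hκ.trans (kappa163_le_rOf d))
  obtain ⟨hz, hz', h0, h1⟩ := edge_conditions n hκ1 hdκ hp ν hre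
  have hpt : tr p ν ∈ Strip d κ := tr_mem_Strip hp ν hre
  obtain ⟨hFp, hNp, hYp, _⟩ := denominators_ne_zero n hκ0 hκ hp
  obtain ⟨hFt, hNt, hYt, _⟩ := denominators_ne_zero n hκ0 hκ hpt
  have hd1 : d = (d - 1) + 1 := (Nat.succ_pred_eq_of_pos (Fin.pos ν)).symm
  -- the shift laws, solved for the translated quantities
  have hX : ∑ k' ∈ univ.erase k, Afac n μ k k' (tr p ν) =
      (∑ k' ∈ univ.erase (sigma n ν k), Afac n μ (sigma n ν k) k' p) * DeltaXi n 0 (tr p ν) ^ 2 /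
        DeltaXi n 0 p ^ 2 :=
    eq_div_of_mul_eq (pow_ne_zero 2 h0) (sum_Afac_tr_mul n μ k ν hz hz' h0 h1)
  have hN : Ncal n (tr p ν) = DeltaXi n 0 (tr p ν) ^ 2 * Ncal n p / DeltaXi n 0 p ^ 2 :=
    eq_div_of_mul_eq (pow_ne_zero 2 h0) (Ncal_tr n p ν hz hz' h0 h1)
  have hP : ∏ lam' : Fin d, Yc n lam' (tr p ν) =
      DeltaXi n 0 (tr p ν) ^ ((d - 1) + 1) * (∏ lam' : Fin d, Yc n lam' p) / DeltaXi n 0 p ^ ((d - 1) + 1) := by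
    have h := prodYc_tr_mul n Finset.univ p ν hz hz' h0 h1
    rw [Finset.card_univ, Fintype.card_fin] at h
    rw [← hd1]
    exact eq_div_of_mul_eq (pow_ne_zero d h0) h
  have hYm : Yc n μ (tr p ν) = DeltaXi n 0 (tr p ν) * Yc n μ p / DeltaXi n 0 p :=
    eq_div_of_mul_eq h0 (Yc_tr_mul n μ p ν hz hz' h0 h1)
  have hYl : Yc n lam (tr p ν) = DeltaXi n 0 (tr p ν) * Yc n lam p / DeltaXi n 0 p :=
    eq_div_of_mul_eq h0 (Yc_tr_mul n lam p ν hz hz' h0 h1)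
  have hF : F66 n (tr p ν) = DeltaXi n 0 (tr p ν) ^ (d - 1) * (DeltaXi n 0 p * F66 n p) /
      (DeltaXi n 0 (tr p ν) * DeltaXi n 0 p ^ (d - 1)) := by
    have h := F66_tr_mul n p ν hz hz' h0 h1
    refine eq_div_of_mul_eq (mul_ne_zero h1 (pow_ne_zero _ h0)) ?_
    rw [← h]; ring
  unfold tailC gdir
  rw [dC_tr, uCbar_tr, expFacNeg_tr, hX, hN, hP, hYm, hYl, hF]
  field_simp
  ring

/-- **THE ALIAS RE-INDEXING COVARIANCE OF THE CONTINUED (1.63) MULTIPLIER** across the strip sides: for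
`p′ ∈ Strip d κ` (`0 ≤ κ ≤ κ₁₆₃(d)`) with `Re p′_ν = −π`, every `n ≥ 1`, `μ, λ, l`:
`h_{l;μλ}(p′ + 2πe_ν) = h_{σ_ν l;μλ}(p′)`, `σ_ν l = l + 2πe_ν (mod 2πn)` — the translate of the left side point is
the right side point (`B4StripSums.tr_mem_Strip`) and the family `(h_l)_l` is merely PERMUTED; hence the
fine-momentum function `Σ_l e^{i(p′+l)x} h_{l;μλ}(p′)` is `2π`-periodic across the sides, which is what the contour
shift uses.  No per-`l` periodicity holds. [folklore] -/
theorem h163_tr {κ : ℝ} (hκ0 : 0 ≤ κ) (hκ : κ ≤ kappa163 d) {p : Fin d → ℂ} (hp : p ∈ Strip d κ)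
    (ν : Fin d) (hre : (p ν).re = -Real.pi) (μ lam : Fin d) (k : Fin d → Fin n) :
    h163 n μ lam k (tr p ν) = h163 n μ lam (sigma n ν k) p := by
  unfold h163
  rw [headC_tr n hκ0 hκ hp ν hre μ k, tailC_mul_gdir_tr n hκ0 hκ hp ν hre μ lam k]

/-- the permuted alias sum is the alias sum: `Σ_l ‖h_{σ_ν l}‖ = Σ_l ‖h_l‖` (so the bound `Msum163` is the same on
both sides of the strip). [folklore] -/
theorem sum_norm_h163_sigma (μ lam ν : Fin d) (p : Fin d → ℂ) :
    ∑ k : Fin d → Fin n, ‖h163 n μ lam (sigma n ν k) p‖ = ∑ k : Fin d → Fin n, ‖h163 n μ lam k p‖ :=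
  Equiv.sum_comp (sigmaEquiv n ν) (fun k => ‖h163 n μ lam k p‖)

end Covariance

end Literature.MathematicalPhysics.QuantumFieldTheory.Balaban1983to89.B5Hk163Alias
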